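import Mathlib
import Literature.Analysis.FluidPDE.Tao2016AveragedNS.RenormalisedCascadeWaves
import Summits.NavierStokesRegularity.NavierStokesRegularity.Theorems.WakeRatchetTailRatchetDyadicBlowupRates
import HarnessLib

/-!
# `WakeRatchet.TailRatchet` (stmt-NavierStokesRegularity-21808), door D4′ — the one-shell dyadic CAUCHY blow-up,
# renormalised, satisfies every hypothesis of the single-estimate reduction except post-firing decay

Def-free support lemmas (MODEL lattice ODEs: the scalar dyadic chain `Ẋₙ = Λⁿ⁻¹Xₙ₋₁² − ΛⁿXₙXₙ₊₁` of Tao 2016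
§1.2 / §4 and its renormalisation `W_n(σ) = Λⁿ e^{−σ} X_n(T* − e^{−σ})` of §6.4; nothing here concerns the
Navier–Stokes equations; stmt-21808 is neither proved nor refuted here; no stub of skeleton d00b85951d7c is closed).
For a solution bundle of the shape of `WakeRatchetDyadicCauchy.dyadic_blowup_typeI` through a datum vanishing off
shell `0`: `negShells_eq_zero` (shells below the datum stay zero on `[0,T*)`: weighted Grönwall on the truncated sums
`Σ_{i<N} Λ^{2m}X_m`, `m = −1−i`, driven only by the tail `BΛ^{−1−N}`); `hasDerivAt_renorm` (the renormalised frame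
solves `W_n' = −W_n + ΛW_{n−1}² − Λ⁻¹W_nW_{n+1}`); `exists_active_shell` (lower rate ⟹ some shell has
`ΛⁿX_n(t)(T*−t) > 1/(2(Λ+Λ⁻¹))`); `postFiringDecay_body_of_cauchy` (given the census's POST-FIRING BOUND (D)
«`ΛⁿX_n(t₁)(T*−t₁) ≥ c`, `0 ≤ t₁ ≤ t₂ < T*` ⟹ `ΛⁿX_n(t₂) ≤ D/(T*−t₁)`», the renormalised solution satisfies the whole
hypothesis list of `WakeRatchetDyadicPostFiring.persistentFrames_of_postFiringDecay`).
HONEST FRAMING: elementary real analysis on a MODEL lattice; the estimate (D) is a HYPOTHESIS here; rung 0.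
-/

noncomputable section

set_option linter.dupNamespace false

namespace Summit.NavierStokesRegularity.NavierStokesRegularity.Theorems

namespace WakeRatchetDyadicPostFiring

open Set Filter Topology
open Literature.Analysis.FluidPDE Literature.Analysis.FluidPDE.TaoCascade

variable {Λ : ℝ} {X : ℤ → ℝ → ℝ} {a T : ℝ}

/-! ## Shells below a vanishing datum stay zero -/

/-- **Negative shells vanish.**  Let `Λ > 1` and let `X` solve the dyadic lattice on `(a, T)` (every shell),
regular below `T`, non-negative on `[0, T)` (`0 ∈ (a,T)`), with `X_n(0) = 0` for every `n < 0`.  Then `X_n ≡ 0`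
on `[0, T)` for every `n < 0`.  (Weighted Grönwall: `u_i = Λ^{2m}X_m`, `m = −1−i`, obeys `u_i' ≤ BΛ² u_{i+1}`, so the
truncated sums `S_N = Σ_{i<N} u_i` obey `S_N' ≤ BΛ²(S_N + BΛ^{−1−N})`, `S_N(0) = 0`, whence
`S_N(t) ≤ BΛ^{−1−N}(e^{BΛ²t} − 1) → 0`.)
[cite: Tao2016AveragedNS, §1.2 (dyadic model), §4 Lemma 4.1 (4.8) with `m = 1`; elementary (Grönwall)] -/
theorem negShells_eq_zero (hΛ : 1 < Λ)
    (hlaw : ∀ n : ℤ, ∀ t ∈ Ioo a T,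
      HasDerivAt (X n) (Λ ^ (n - 1) * X (n - 1) t ^ 2 - Λ ^ n * X n t * X (n + 1) t) t)
    (hreg : ∀ T', T' < T → ∃ B : ℝ, ∀ n : ℤ, ∀ t ∈ Ioo a T', |Λ ^ n * X n t| ≤ B)
    (h0 : (0 : ℝ) ∈ Ioo a T) (hnn : ∀ n : ℤ, ∀ t ∈ Ico 0 T, 0 ≤ X n t)
    (hdata : ∀ n : ℤ, n < 0 → X n 0 = 0) :
    ∀ n : ℤ, n < 0 → ∀ t ∈ Ico 0 T, X n t = 0 := by
  have hΛ0 : 0 < Λ := by linarith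
  have hΛne : Λ ≠ 0 := hΛ0.ne'
  intro n hn t ht
  -- regularity bound on `[0, t]`
  obtain ⟨B, hB⟩ := hreg ((t + T) / 2) (by linarith [ht.2])
  have hsub : ∀ u ∈ Icc 0 t, u ∈ Ioo a ((t + T) / 2) := fun u hu => ⟨h0.1.trans_le hu.1, by linarith [hu.2, ht.2]⟩
  have hsub' : ∀ u ∈ Icc 0 t, u ∈ Ioo a T := fun u hu => ⟨h0.1.trans_le hu.1, lt_of_le_of_lt hu.2 ht.2⟩
  have hsub'' : ∀ u ∈ Icc 0 t, u ∈ Ico 0 T := fun u hu => ⟨hu.1, lt_of_le_of_lt hu.2 ht.2⟩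
  have hB0 : 0 ≤ B := (abs_nonneg _).trans (hB 0 0 (hsub 0 ⟨le_rfl, ht.1⟩))
  -- the weighted negative shells `w i u = Λ^m (Λ^m X_m(u))`, `m = -1 - i`
  set m : ℕ → ℤ := fun i => -1 - (i : ℤ) with hm
  have hm_succ : ∀ i : ℕ, m (i + 1) = m i - 1 := fun i => by simp only [hm]; push_cast; ring
  set w : ℕ → ℝ → ℝ := fun i u => Λ ^ m i * (Λ ^ m i * X (m i) u) with hw
  set K : ℝ := B * Λ ^ 2 with hK
  have hK0 : 0 ≤ K := by positivity
  -- non-negativity and the tail bound of the weights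
  have hw0 : ∀ (i : ℕ), ∀ u ∈ Icc 0 t, 0 ≤ w i u := fun i u hu =>
    mul_nonneg (zpow_pos hΛ0 _).le (mul_nonneg (zpow_pos hΛ0 _).le (hnn _ u (hsub'' u hu)))
  have hwB : ∀ (i : ℕ), ∀ u ∈ Icc 0 t, w i u ≤ B * Λ ^ m i := by
    intro i u hu
    have h1 : Λ ^ m i * X (m i) u ≤ B := (le_abs_self _).trans (hB _ u (hsub u hu))
    have h2 : 0 < Λ ^ m i := zpow_pos hΛ0 _
    calc w i u = Λ ^ m i * (Λ ^ m i * X (m i) u) := rfl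
      _ ≤ Λ ^ m i * B := mul_le_mul_of_nonneg_left h1 h2.le
      _ = B * Λ ^ m i := mul_comm _ _
  -- the derivative of a weight is paid by the next one: `w_i' ≤ K w_{i+1}`
  have hwd : ∀ (i : ℕ), ∀ u ∈ Icc 0 t, HasDerivAt (w i)
      (Λ ^ m i * (Λ ^ m i * (Λ ^ (m i - 1) * X (m i - 1) u ^ 2 - Λ ^ m i * X (m i) u * X (m i + 1) u))) u :=
    fun i u hu => ((hlaw (m i) u (hsub' u hu)).const_mul _).const_mul _
  have hwd_le : ∀ (i : ℕ), ∀ u ∈ Icc 0 t,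
      Λ ^ m i * (Λ ^ m i * (Λ ^ (m i - 1) * X (m i - 1) u ^ 2 - Λ ^ m i * X (m i) u * X (m i + 1) u))
        ≤ K * w (i + 1) u := by
    intro i u hu
    have hq : 0 < Λ ^ (m i - 1) := zpow_pos hΛ0 _
    have hp : 0 < Λ ^ m i := zpow_pos hΛ0 _
    have hy0 : 0 ≤ X (m i - 1) u := hnn _ u (hsub'' u hu)
    have hyB : Λ ^ (m i - 1) * X (m i - 1) u ≤ B := (le_abs_self _).trans (hB _ u (hsub u hu))
    have hx0 : 0 ≤ X (m i) u := hnn _ u (hsub'' u hu)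
    have hz0 : 0 ≤ X (m i + 1) u := hnn _ u (hsub'' u hu)
    have hΛm : Λ ^ m i = Λ ^ (m i - 1) * Λ := by
      rw [zpow_sub_one₀ hΛne, mul_assoc, inv_mul_cancel₀ hΛne, mul_one]
    have hQ : 0 ≤ Λ ^ m i * (Λ ^ m i * (Λ ^ m i * X (m i) u * X (m i + 1) u)) := by positivity
    have hP : Λ ^ m i * (Λ ^ m i * (Λ ^ (m i - 1) * X (m i - 1) u ^ 2))
        = Λ ^ 2 * (Λ ^ (m i - 1) * (Λ ^ (m i - 1) * X (m i - 1) u) * (Λ ^ (m i - 1) * X (m i - 1) u)) := by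
      rw [hΛm]; ring
    have h1 : Λ ^ (m i - 1) * (Λ ^ (m i - 1) * X (m i - 1) u) * (Λ ^ (m i - 1) * X (m i - 1) u)
        ≤ Λ ^ (m i - 1) * (Λ ^ (m i - 1) * X (m i - 1) u) * B :=
      mul_le_mul_of_nonneg_left hyB (by positivity)
    have h2 : Λ ^ 2 * (Λ ^ (m i - 1) * (Λ ^ (m i - 1) * X (m i - 1) u) * (Λ ^ (m i - 1) * X (m i - 1) u))
        ≤ Λ ^ 2 * (Λ ^ (m i - 1) * (Λ ^ (m i - 1) * X (m i - 1) u) * B) :=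
      mul_le_mul_of_nonneg_left h1 (by positivity)
    simp only [hw]
    rw [hm_succ i]
    have expand : Λ ^ m i * (Λ ^ m i * (Λ ^ (m i - 1) * X (m i - 1) u ^ 2
          - Λ ^ m i * X (m i) u * X (m i + 1) u))
        = Λ ^ m i * (Λ ^ m i * (Λ ^ (m i - 1) * X (m i - 1) u ^ 2))
          - Λ ^ m i * (Λ ^ m i * (Λ ^ m i * X (m i) u * X (m i + 1) u)) := by ring
    rw [expand, hP, hK]
    linarith [hQ, h2]
  -- truncated sums
  set S : ℕ → ℝ → ℝ := fun N u => ∑ i ∈ Finset.range N, w i u with hS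
  have hS0 : ∀ N, S N 0 = 0 := by
    intro N
    simp only [hS]
    refine Finset.sum_eq_zero fun i _ => ?_
    simp only [hw, hdata (m i) (by simp only [hm]; omega), mul_zero]
  have hSd : ∀ (N : ℕ), ∀ u ∈ Icc 0 t, ∃ S' : ℝ, HasDerivAt (S N) S' u ∧ S' ≤ K * S N u + K * (B * Λ ^ m N) := by
    intro N u hu
    refine ⟨∑ i ∈ Finset.range N, Λ ^ m i * (Λ ^ m i * (Λ ^ (m i - 1) * X (m i - 1) u ^ 2
        - Λ ^ m i * X (m i) u * X (m i + 1) u)), ?_, ?_⟩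
    · exact HasDerivAt.fun_sum fun i _ => hwd i u hu
    · calc (∑ i ∈ Finset.range N, Λ ^ m i * (Λ ^ m i * (Λ ^ (m i - 1) * X (m i - 1) u ^ 2
              - Λ ^ m i * X (m i) u * X (m i + 1) u)))
          ≤ ∑ i ∈ Finset.range N, K * w (i + 1) u := Finset.sum_le_sum fun i _ => hwd_le i u hu
        _ = K * ∑ i ∈ Finset.range N, w (i + 1) u := by rw [Finset.mul_sum]
        _ = K * (S N u - w 0 u + w N u) := by
            congr 1
            have h := Finset.sum_range_succ' (fun i => w i u) N
            have h' := Finset.sum_range_succ (fun i => w i u) N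
            simp only [hS]
            linarith
        _ ≤ K * S N u + K * (B * Λ ^ m N) := by
            have h1 := hw0 0 u hu
            have h2 := hwB N u hu
            nlinarith
  -- Grönwall: `S N t ≤ B Λ^{m N} (e^{Kt} - 1)`
  have hgron : ∀ N : ℕ, S N t ≤ B * Λ ^ m N * (Real.exp (K * t) - 1) := by
    intro N
    set e : ℝ := B * Λ ^ m N with he
    set g : ℝ → ℝ := fun u => Real.exp (-(K * u)) * (S N u + e) with hg
    have hgd : ∀ u ∈ Icc 0 t, ∃ g' : ℝ, HasDerivAt g g' u ∧ g' ≤ 0 := by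
      intro u hu
      obtain ⟨S', hS', hle⟩ := hSd N u hu
      have h1 : HasDerivAt (fun u => -(K * u)) (-K) u :=
        (((hasDerivAt_id' u).const_mul K).neg).congr_deriv (by ring)
      refine ⟨Real.exp (-(K * u)) * (-K) * (S N u + e) + Real.exp (-(K * u)) * S', ?_, ?_⟩
      · exact (h1.exp.mul (hS'.add_const e))
      · have hexp : 0 < Real.exp (-(K * u)) := Real.exp_pos _
        nlinarith
    have hgc : ContinuousOn g (Icc 0 t) := fun u hu =>
      (hgd u hu).choose_spec.1.continuousAt.continuousWithinAt
    have hanti : AntitoneOn g (Icc 0 t) := by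
      refine antitoneOn_of_deriv_nonpos (convex_Icc 0 t) hgc ?_ ?_
      · intro u hu
        rw [interior_Icc] at hu
        exact (hgd u ⟨hu.1.le, hu.2.le⟩).choose_spec.1.differentiableAt.differentiableWithinAt
      · intro u hu
        rw [interior_Icc] at hu
        obtain ⟨g', hg', hle⟩ := hgd u ⟨hu.1.le, hu.2.le⟩
        rw [hg'.deriv]
        exact hle
    have h1 := hanti (left_mem_Icc.2 ht.1) (right_mem_Icc.2 ht.1) ht.1
    simp only [hg, hS0, mul_zero, neg_zero, Real.exp_zero, one_mul, zero_add] at h1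
    -- `e^{-Kt} (S N t + e) ≤ e`
    have hexp : 0 < Real.exp (K * t) := Real.exp_pos _
    have h2 : S N t + e ≤ Real.exp (K * t) * e := by
      have h3 : Real.exp (K * t) * (Real.exp (-(K * t)) * (S N t + e)) ≤ Real.exp (K * t) * e :=
        mul_le_mul_of_nonneg_left h1 hexp.le
      rwa [← mul_assoc, ← Real.exp_add, add_neg_cancel, Real.exp_zero, one_mul] at h3
    linarith
  -- the shell `n = m i₀`
  obtain ⟨i₀, hi₀⟩ : ∃ i₀ : ℕ, m i₀ = n := ⟨(-1 - n).toNat, by simp only [hm]; omega⟩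
  have hwi : ∀ N : ℕ, i₀ < N → w i₀ t ≤ B * Λ ^ m N * (Real.exp (K * t) - 1) := by
    intro N hN
    have h1 : w i₀ t ≤ S N t := by
      simp only [hS]
      exact Finset.single_le_sum (f := fun i => w i t) (fun i _ => hw0 i t (right_mem_Icc.2 ht.1))
        (Finset.mem_range.2 hN)
    exact h1.trans (hgron N)
  -- the tail `B Λ^{m N} (e^{Kt} - 1) → 0`
  have htend : Tendsto (fun N : ℕ => B * Λ ^ m N * (Real.exp (K * t) - 1)) atTop (𝓝 0) := by
    have h1 : Tendsto (fun N : ℕ => (Λ⁻¹) ^ (N + 1)) atTop (𝓝 0) :=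
      (tendsto_pow_atTop_nhds_zero_of_lt_one (inv_nonneg.2 hΛ0.le) (inv_lt_one_of_one_lt₀ hΛ)).comp
        (tendsto_add_atTop_nat 1)
    have h2 : (fun N : ℕ => B * Λ ^ m N * (Real.exp (K * t) - 1))
        = fun N : ℕ => B * (Real.exp (K * t) - 1) * (Λ⁻¹) ^ (N + 1) := by
      funext N
      have : Λ ^ m N = (Λ⁻¹) ^ (N + 1) := by
        simp only [hm]
        rw [← zpow_natCast, inv_zpow', show -((N + 1 : ℕ) : ℤ) = -1 - (N : ℤ) by push_cast; ring]
      rw [this]; ring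
    rw [h2]
    simpa using h1.const_mul (B * (Real.exp (K * t) - 1))
  have hle0 : w i₀ t ≤ 0 :=
    ge_of_tendsto htend (Filter.eventually_atTop.2 ⟨i₀ + 1, fun N hN => hwi N (by omega)⟩)
  have hw_zero : w i₀ t = 0 := le_antisymm hle0 (hw0 i₀ t (right_mem_Icc.2 ht.1))
  have hp : 0 < Λ ^ m i₀ := zpow_pos hΛ0 _
  have : Λ ^ m i₀ * (Λ ^ m i₀ * X (m i₀) t) = 0 := hw_zero
  rw [← hi₀]
  simpa [hp.ne'] using this

/-! ## The renormalised frame solves the renormalised lattice -/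

/-- **Chain rule.**  If `X` solves the dyadic lattice on `(a, T)`, then `W_n(σ) = Λⁿ e^{−σ} X_n(T − e^{−σ})` solves
`W_n' = −W_n + ΛW_{n−1}² − Λ⁻¹W_nW_{n+1}` at every `σ` with `T − e^{−σ} ∈ (a, T)`.
[cite: Tao2016AveragedNS, §6.4 (self-similar variables) applied to §4 Lemma 4.1 (4.8), `m = 1`; elementary] -/
theorem hasDerivAt_renorm (hΛ : 0 < Λ)
    (hlaw : ∀ n : ℤ, ∀ t ∈ Ioo a T,
      HasDerivAt (X n) (Λ ^ (n - 1) * X (n - 1) t ^ 2 - Λ ^ n * X n t * X (n + 1) t) t)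
    (n : ℤ) {σ : ℝ} (hσ : T - Real.exp (-σ) ∈ Ioo a T) :
    HasDerivAt (fun σ => Λ ^ n * (Real.exp (-σ) * X n (T - Real.exp (-σ))))
      (-(Λ ^ n * (Real.exp (-σ) * X n (T - Real.exp (-σ))))
        + Λ * (Λ ^ (n - 1) * (Real.exp (-σ) * X (n - 1) (T - Real.exp (-σ)))) ^ 2
        - Λ⁻¹ * (Λ ^ n * (Real.exp (-σ) * X n (T - Real.exp (-σ))))
          * (Λ ^ (n + 1) * (Real.exp (-σ) * X (n + 1) (T - Real.exp (-σ))))) σ := by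
  have hΛne : Λ ≠ 0 := hΛ.ne'
  set t : ℝ := T - Real.exp (-σ) with ht
  -- inner map `σ ↦ T - e^{-σ}` has derivative `e^{-σ}`
  have hneg : HasDerivAt (fun σ : ℝ => -σ) (-1) σ := (hasDerivAt_id' σ).neg
  have hexp : HasDerivAt (fun σ : ℝ => Real.exp (-σ)) (Real.exp (-σ) * (-1)) σ := hneg.exp
  have hinner : HasDerivAt (fun σ : ℝ => T - Real.exp (-σ)) (Real.exp (-σ)) σ :=
    (hexp.const_sub T).congr_deriv (by ring)
  have hX : HasDerivAt (fun σ : ℝ => X n (T - Real.exp (-σ)))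
      ((Λ ^ (n - 1) * X (n - 1) t ^ 2 - Λ ^ n * X n t * X (n + 1) t) * Real.exp (-σ)) σ :=
    HasDerivAt.comp σ (hlaw n t hσ) hinner
  have hprod := (hexp.mul hX).const_mul (Λ ^ n)
  refine hprod.congr_deriv ?_
  have e1 : Λ ^ (n - 1) = Λ ^ n * Λ⁻¹ := zpow_sub_one₀ hΛne n
  have e2 : Λ ^ (n + 1) = Λ ^ n * Λ := zpow_add_one₀ hΛne n
  simp only [ht]
  rw [e1, e2]
  field_simp
  ring

/-! ## The lower blow-up rate in renormalised form -/

/-- **Some shell is active at every log-time.**  The lower rate «`1 ≤ (Λ+Λ⁻¹)β(T−t)` for every frame bound `β`»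
gives, at every `t ∈ [0,T)`, a shell with `Λⁿ X_n(t) (T − t) > 1/(2(Λ+Λ⁻¹))` (non-negative solution).
[cite: Tao2016AveragedNS, §6.4; elementary] -/
theorem exists_active_shell (hΛ : 0 < Λ)
    (hnn : ∀ n : ℤ, ∀ t ∈ Ico 0 T, 0 ≤ X n t)
    (hlow : ∀ t ∈ Ioo a T, ∀ β : ℝ, 0 < β →
      (∀ n : ℤ, |Λ ^ n * X n t| ≤ β) → 1 ≤ (Λ + Λ⁻¹) * β * (T - t))
    {t : ℝ} (ht : t ∈ Ico 0 T) (hta : a < t) :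
    ∃ n : ℤ, 1 / (2 * (Λ + Λ⁻¹)) < Λ ^ n * X n t * (T - t) := by
  have hL : 0 < Λ + Λ⁻¹ := by positivity
  have hTt : 0 < T - t := by linarith [ht.2]
  set β : ℝ := 1 / (2 * (Λ + Λ⁻¹) * (T - t)) with hβ
  have hβ0 : 0 < β := by positivity
  by_contra h
  push Not at h
  have hall : ∀ n : ℤ, |Λ ^ n * X n t| ≤ β := by
    intro n
    have h0 : 0 ≤ Λ ^ n * X n t := mul_nonneg (zpow_pos hΛ n).le (hnn n t ht)
    rw [abs_of_nonneg h0]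
    have h1 := h n
    rw [hβ, le_div_iff₀ (by positivity)]
    calc Λ ^ n * X n t * (2 * (Λ + Λ⁻¹) * (T - t)) = 2 * (Λ + Λ⁻¹) * (Λ ^ n * X n t * (T - t)) := by ring
      _ ≤ 2 * (Λ + Λ⁻¹) * (1 / (2 * (Λ + Λ⁻¹))) := mul_le_mul_of_nonneg_left h1 (by positivity)
      _ = 1 := by field_simp
  have h2 := hlow t ⟨hta, ht.2⟩ β hβ0 hall
  have h3 : (Λ + Λ⁻¹) * β * (T - t) = 1 / 2 := by
    rw [hβ]
    field_simp
  linarith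

/-! ## Assembly: the renormalised Cauchy blow-up under the post-firing bound (D) -/

/-- **The one-shell Cauchy blow-up, renormalised, satisfies the hypotheses of the single-estimate reduction given
(D).**  Let `Λ = bigLam ε₀` and let `(T*, X)` be a solution bundle of the shape of
`WakeRatchetDyadicCauchy.dyadic_blowup_typeI` through a non-negative datum vanishing off shell `0`
(law on `(−δ₀, T*)`, `δ₀ > 0`, `T* > 0`; regular below `T*`; non-negative on `[0,T*)`; type-I frame bound; lower
rate), and assume the POST-FIRING BOUND (D): `ΛⁿX_n(t₁)(T*−t₁) ≥ c`, `0 ≤ t₁ ≤ t₂ < T*` ⟹ `ΛⁿX_n(t₂) ≤ D/(T*−t₁)`,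
`c = 1/(2(Λ+Λ⁻¹))`.  Then `W_n(σ) = Λⁿe^{−σ}X_n(T* − e^{−σ})`, `A₀ = −log(T*+δ₀)`, `A = −log T*`,
`B = 2Λ²/(Λ−1)²`, `c`, `D` satisfy: law on `σ > A₀`, `0 ≤ W ≤ B` on `σ ≥ A`, quiet start, lower rate at level
`c` with `Λc < 1`, and post-firing decay (D′).
[cite: Tao2016AveragedNS, §1.2, §4 Lemma 4.1 (4.8) with `m = 1`, §6.4; elementary] -/
theorem postFiringDecay_body_of_cauchy {ε₀ : ℝ} (hε₀ : 0 < ε₀) {δ₀ Tstar : ℝ} (hδ₀ : 0 < δ₀)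
    (hT : 0 < Tstar) {X : ℤ → ℝ → ℝ}
    (hdata : ∀ n : ℤ, n ≠ 0 → X n 0 = 0)
    (hlaw : ∀ n : ℤ, ∀ t ∈ Ioo (-δ₀) Tstar, HasDerivAt (X n)
      (bigLam ε₀ ^ (n - 1) * X (n - 1) t ^ 2 - bigLam ε₀ ^ n * X n t * X (n + 1) t) t)
    (hreg : ∀ T', T' < Tstar → ∃ B : ℝ, ∀ n : ℤ, ∀ t ∈ Ioo (-δ₀) T', |bigLam ε₀ ^ n * X n t| ≤ B)
    (hnn : ∀ n : ℤ, ∀ t ∈ Ico 0 Tstar, 0 ≤ X n t)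
    (htypeI : ∀ n : ℤ, ∀ t ∈ Ico 0 Tstar,
      bigLam ε₀ ^ n * X n t * (Tstar - t) ≤ 2 * bigLam ε₀ ^ 2 / (bigLam ε₀ - 1) ^ 2)
    (hlow : ∀ t ∈ Ioo (-δ₀) Tstar, ∀ β : ℝ, 0 < β →
      (∀ n : ℤ, |bigLam ε₀ ^ n * X n t| ≤ β) → 1 ≤ (bigLam ε₀ + (bigLam ε₀)⁻¹) * β * (Tstar - t))
    {D : ℝ}
    (hD : ∀ (n : ℤ) (t₁ t₂ : ℝ), 0 ≤ t₁ → t₁ ≤ t₂ → t₂ < Tstar →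
      1 / (2 * (bigLam ε₀ + (bigLam ε₀)⁻¹)) ≤ bigLam ε₀ ^ n * X n t₁ * (Tstar - t₁) →
        bigLam ε₀ ^ n * X n t₂ ≤ D / (Tstar - t₁)) :
    ∃ (W : ℤ → ℝ → ℝ) (A₀ A B c D' : ℝ), A₀ < A ∧ 0 < c ∧ bigLam ε₀ * c < 1 ∧
      (∀ (n : ℤ) (σ : ℝ), A₀ < σ → HasDerivAt (W n)
        (-(W n σ) + bigLam ε₀ * W (n - 1) σ ^ 2 - (bigLam ε₀)⁻¹ * W n σ * W (n + 1) σ) σ) ∧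
      (∀ (n : ℤ) (σ : ℝ), A ≤ σ → 0 ≤ W n σ ∧ W n σ ≤ B) ∧
      (∀ n : ℤ, n < 0 → ∀ σ : ℝ, A ≤ σ → W n σ = 0) ∧
      (∀ n : ℤ, 0 < n → W n A = 0) ∧
      (∀ σ : ℝ, A ≤ σ → ∃ n : ℤ, c ≤ W n σ) ∧
      (∀ (n : ℤ) (σ₁ σ₂ : ℝ), A ≤ σ₁ → σ₁ ≤ σ₂ → c ≤ W n σ₁ →
        W n σ₂ ≤ D' * Real.exp (-(σ₂ - σ₁))) := by
  set Λ : ℝ := bigLam ε₀ with hΛdef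
  have hΛ1 : 1 < Λ := by
    rw [hΛdef]; unfold bigLam; exact Real.one_lt_rpow (by linarith) (by norm_num)
  have hΛ0 : 0 < Λ := by linarith
  have hL : 0 < Λ + Λ⁻¹ := by positivity
  set A₀ : ℝ := -Real.log (Tstar + δ₀) with hA₀
  set A : ℝ := -Real.log Tstar with hA
  set c : ℝ := 1 / (2 * (Λ + Λ⁻¹)) with hc
  set W : ℤ → ℝ → ℝ := fun n σ => Λ ^ n * (Real.exp (-σ) * X n (Tstar - Real.exp (-σ))) with hW
  -- the time map
  have hexpA : Real.exp (-A) = Tstar := by rw [hA, neg_neg, Real.exp_log hT]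
  have hexpA₀ : Real.exp (-A₀) = Tstar + δ₀ := by rw [hA₀, neg_neg, Real.exp_log (by linarith)]
  have htime_lt : ∀ σ : ℝ, A₀ < σ → Tstar - Real.exp (-σ) ∈ Ioo (-δ₀) Tstar := by
    intro σ hσ
    refine ⟨?_, by linarith [Real.exp_pos (-σ)]⟩
    have : Real.exp (-σ) < Real.exp (-A₀) := Real.exp_lt_exp.2 (by linarith)
    rw [hexpA₀] at this
    linarith
  have htime_le : ∀ σ : ℝ, A ≤ σ → Tstar - Real.exp (-σ) ∈ Ico 0 Tstar := by
    intro σ hσ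
    refine ⟨?_, by linarith [Real.exp_pos (-σ)]⟩
    have : Real.exp (-σ) ≤ Real.exp (-A) := Real.exp_le_exp.2 (by linarith)
    rw [hexpA] at this
    linarith
  have hA₀A : A₀ < A := by
    rw [hA₀, hA]
    exact neg_lt_neg (Real.log_lt_log hT (by linarith))
  have h0mem : (0 : ℝ) ∈ Ioo (-δ₀) Tstar := ⟨by linarith, hT⟩
  -- negative shells vanish
  have hneg0 : ∀ n : ℤ, n < 0 → ∀ t ∈ Ico 0 Tstar, X n t = 0 :=
    negShells_eq_zero hΛ1 hlaw hreg h0mem hnn (fun n hn => hdata n hn.ne)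
  refine ⟨W, A₀, A, 2 * Λ ^ 2 / (Λ - 1) ^ 2, c, D, hA₀A, by positivity, ?_, ?_, ?_, ?_, ?_, ?_, ?_⟩
  · -- `Λ c < 1`
    rw [hc]
    have hinv : 0 < Λ⁻¹ := inv_pos.2 hΛ0
    rw [mul_one_div, div_lt_one (by positivity)]
    nlinarith
  · -- the law
    intro n σ hσ
    have h := hasDerivAt_renorm (T := Tstar) hΛ0 hlaw n (htime_lt σ hσ)
    exact h
  · -- `0 ≤ W ≤ B`
    intro n σ hσ
    have ht := htime_le σ hσ
    have hX0 : 0 ≤ X n (Tstar - Real.exp (-σ)) := hnn n _ ht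
    have h1 := htypeI n _ ht
    refine ⟨by positivity, ?_⟩
    show Λ ^ n * (Real.exp (-σ) * X n (Tstar - Real.exp (-σ))) ≤ 2 * Λ ^ 2 / (Λ - 1) ^ 2
    have : Λ ^ n * (Real.exp (-σ) * X n (Tstar - Real.exp (-σ)))
        = Λ ^ n * X n (Tstar - Real.exp (-σ)) * (Tstar - (Tstar - Real.exp (-σ))) := by ring
    rw [this]
    exact h1
  · -- negative shells
    intro n hn σ hσ
    show Λ ^ n * (Real.exp (-σ) * X n (Tstar - Real.exp (-σ))) = 0
    rw [hneg0 n hn _ (htime_le σ hσ), mul_zero, mul_zero]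
  · -- quiet start above the datum
    intro n hn
    show Λ ^ n * (Real.exp (-A) * X n (Tstar - Real.exp (-A))) = 0
    rw [hexpA, sub_self, hdata n hn.ne', mul_zero, mul_zero]
  · -- lower rate at level `c`
    intro σ hσ
    have ht := htime_le σ hσ
    obtain ⟨n, hn⟩ := exists_active_shell (a := -δ₀) hΛ0 hnn hlow ht (by linarith [ht.1])
    refine ⟨n, ?_⟩
    show c ≤ Λ ^ n * (Real.exp (-σ) * X n (Tstar - Real.exp (-σ)))
    have : Λ ^ n * (Real.exp (-σ) * X n (Tstar - Real.exp (-σ)))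
        = Λ ^ n * X n (Tstar - Real.exp (-σ)) * (Tstar - (Tstar - Real.exp (-σ))) := by ring
    rw [this, hc]
    exact hn.le
  · -- post-firing decay from (D)
    intro n σ₁ σ₂ hσ₁ h12 hfire
    have ht₁ := htime_le σ₁ hσ₁
    have ht₂ := htime_le σ₂ (hσ₁.trans h12)
    have he12 : Real.exp (-σ₂) ≤ Real.exp (-σ₁) := Real.exp_le_exp.2 (by linarith)
    have hfire' : 1 / (2 * (Λ + Λ⁻¹)) ≤ Λ ^ n * X n (Tstar - Real.exp (-σ₁)) * (Tstar - (Tstar - Real.exp (-σ₁))) := by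
      have : Λ ^ n * X n (Tstar - Real.exp (-σ₁)) * (Tstar - (Tstar - Real.exp (-σ₁)))
          = Λ ^ n * (Real.exp (-σ₁) * X n (Tstar - Real.exp (-σ₁))) := by ring
      rw [this, ← hc]; exact hfire
    have h := hD n _ _ ht₁.1 (by linarith) ht₂.2 hfire'
    rw [sub_sub_cancel] at h
    -- `W n σ₂ = e^{-σ₂} Λⁿ X_n(t₂) ≤ e^{-σ₂} D / e^{-σ₁}`
    have hpos : 0 < Real.exp (-σ₁) := Real.exp_pos _
    show Λ ^ n * (Real.exp (-σ₂) * X n (Tstar - Real.exp (-σ₂))) ≤ D * Real.exp (-(σ₂ - σ₁))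
    have e1 : Real.exp (-(σ₂ - σ₁)) = Real.exp (-σ₂) / Real.exp (-σ₁) := by
      rw [← Real.exp_sub]; congr 1; ring
    rw [e1]
    calc Λ ^ n * (Real.exp (-σ₂) * X n (Tstar - Real.exp (-σ₂)))
        = Real.exp (-σ₂) * (Λ ^ n * X n (Tstar - Real.exp (-σ₂))) := by ring
      _ ≤ Real.exp (-σ₂) * (D / Real.exp (-σ₁)) :=
          mul_le_mul_of_nonneg_left h (Real.exp_pos _).le
      _ = D * (Real.exp (-σ₂) / Real.exp (-σ₁)) := by ring

end WakeRatchetDyadicPostFiring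

end Summit.NavierStokesRegularity.NavierStokesRegularity.Theorems

end
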